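import Mathlib.Algebra.Algebra.Hom.Rat
import Literature.NumberTheory.EllipticCurves.IwasawaZpRankGlobalReciprocityProofs
import Literature.NumberTheory.EllipticCurves.ZpExtensionRankTransportProofs
import Literature.NumberTheory.GaloisRepresentations.GlobalReciprocityLawProofs
import HarnessLib

/-!
# BSD family: the `ℤ_p`-rank of an imaginary quadratic field — the upper bound, unconditionally

Sibling proofs file of `Literature/NumberTheory/EllipticCurves/Iwasawa.lean` (**bsd.S22**) for the
named fact `Literature.NumberTheory.EllipticCurves.zpRank_imaginaryQuadratic K p`
(`Gal(K̃/K) ≃ ℤ_p²` for `K` imaginary quadratic: Washington, *Introduction to Cyclotomic Fields*,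
Thm. 13.4 with `r₂ = 1`; Lang, *Cyclotomic Fields I and II*, Ch. 5 §5 Thm. 5.2).  Theorems only:
no definition, no named fact, no instance (D-0026).

The tree's `IwasawaZpRankGlobalReciprocityProofs.lean` derives the fact from the named fact
`GaloisRepresentations.exists_isGlobalReciprocityMap K` (Neukirch, *Bonn Lectures* III (7.12):
the Artin map `C_K → Γ_K^ab` is continuous and surjective, with kernel the divisible classes, and
the existence theorem).  Its **upper-bound half** — Washington's
"`rank_{ℤ_p} Gal(K̃/K) ≤ ∑_{𝔭∣p} [K_𝔭 : ℚ_p] = [K : ℚ]`" (§13.1, proof of Thm. 13.4), in the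
form `exists_ne_zero_sum_mul_eq_zero`: *more than `[K : ℚ]` continuous `ℤ_p`-valued characters
of `Γ_K` are `ℤ_p`-linearly dependent* — uses of the reciprocity map `θ` only that it is
**continuous** and **surjective** (a character of `Γ_K` pulls back along `θ` to an idelic
character trivial on `Kˣ`, and is recovered from it).  Since 2026-08-15 both properties are
theorems of the tree for every number field `K : Type`: the global reciprocity law
(`GaloisRepresentations.GlobalReciprocityLawProofs`: `isGlobalReciprocitySystem_artinMap K`, the
Artin maps `ψ_{L|K}` of all finite abelian `L ⊆ K̄` from `artinReciprocity_character_holds`, and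
`continuous_and_surjective_theta K`: their limit `( , K) : C_K → Γ_K^ab` is continuous and
surjective — Neukirch III (7.12) without the kernel clause / existence theorem).

This file records the consequence:

* `exists_idelicCharacter_of_character_of_continuous`, `exists_ne_zero_sum_mul_eq_zero_of_surjective`
  — the two steps of `IwasawaZpRankGlobalReciprocityProofs` with the hypothesis
  `IsGlobalReciprocityMap K θ` weakened to `Continuous θ`, resp. `Continuous θ ∧ Surjective θ`
  (same proofs);
* `exists_ne_zero_sum_mul_eq_zero₀` (`K : Type`) and `exists_ne_zero_sum_mul_eq_zero'`
  (`K : Type u`, by transport to a model in `Type` along `Γ_{K₀} ≃ₜ* Γ_K`,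
  `ZpExtensionRankTransportProofs`) — **unconditionally, any `m > [K : ℚ]` continuous characters
  `Γ_K →ₜ* ℤ_p` of a number field satisfy a non-trivial `ℤ_p`-linear relation**
  (`rank_{ℤ_p} Hom_cont(Γ_K, ℤ_p) ≤ [K : ℚ]`);
* `kerSubgroup_inf_le_kerSubgroup_of_surjective` — **the upper bound of Washington Thm. 13.4 for
  `[K : ℚ] ≤ 2`, unconditionally**: if `κ₁, κ₂` are `ℤ_p`-extensions of `K` with
  `(κ₁, κ₂) : Γ_K → ℤ_p × ℤ_p` surjective, then every `ℤ_p`-extension `κ` of `K` lies in their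
  compositum, `ker κ₁ ⊓ ker κ₂ ≤ ker κ`;
* `zpRank_imaginaryQuadratic_of_exists_pair`, `zpRank_imaginaryQuadratic_of_exists_pair'` —
  **what remains for `zpRank_imaginaryQuadratic_holds` is exactly its lower-bound half**: two
  `ℤ_p`-extensions of the imaginary quadratic field `K` with `(κ₁, κ₂)` jointly surjective
  (`rank ≥ r₂ + 1 = 2`), i.e. the existence theorem of global class field theory (Takagi;
  Neukirch III (7.7)–(7.8); Tate, Cassels–Fröhlich VII §5.1 (D)), the one input of
  `exists_isGlobalReciprocityMap K` not yet in the tree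
  (`GaloisRepresentations.exists_isGlobalReciprocityMap_of_kummer`).

## References

* [Washington1997] L. C. Washington, *Introduction to Cyclotomic Fields*, 2nd ed., GTM 83,
  Springer 1997, §13.1, Thm. 13.4 and its proof (`rank ≤ ∑_{𝔭∣p}[K_𝔭:ℚ_p] − rank Ē₁`).
* [Lang1990] S. Lang, *Cyclotomic Fields I and II*, GTM 121, Springer 1990, Ch. 5 §5,
  Thm. 5.1–5.2 (PDF p. 107 of the held copy).
* [Neukirch2013] J. Neukirch, *Class Field Theory — The Bonn Lectures*, Springer 2013, Part III
  Thm. (7.7), (7.8), (7.12).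
-/

noncomputable section

universe u v

open NumberField IsDedekindDomain Field Topology

namespace Literature.NumberTheory.EllipticCurves.ZpExtension

section General

variable {K : Type u} [Field K] [NumberField K] {p : ℕ} [Fact p.Prime]

/-! ### Pulling characters of `Γ_K` back along a continuous `θ : C_K → Γ_K^ab` -/

/-- **A continuous character of `Γ_K` pulls back along any continuous `θ : C_K → Γ_K^ab` to a
continuous character of `𝕀_K` trivial on `Kˣ`** (the tree's
`exists_idelicCharacter_of_character`, with `IsGlobalReciprocityMap K θ` weakened to
`Continuous θ`, same proof): `χ : Γ_K →ₜ* ℤ_p` kills `\overline{[Γ_K, Γ_K]}`, so factors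
continuously through `Γ_K^ab`, and `f = χ^ab ∘ θ ∘ (𝕀_K → C_K)` is continuous, trivial on the
principal ideles, with `f x = χ σ` whenever `θ [x] = [σ]`.
Ref: Washington, *Introduction to Cyclotomic Fields*, §13.1, proof of Thm. 13.4. [folklore] -/
theorem exists_idelicCharacter_of_character_of_continuous
    {θ : GaloisRepresentations.ideleGroup K ⧸ GaloisRepresentations.principalIdeles K →*
      absoluteGaloisGroupAbelianization K}
    (hθc : Continuous θ) (χ : absoluteGaloisGroup K →ₜ* Multiplicative ℤ_[p]) :
    ∃ f : GaloisRepresentations.ideleGroup K →ₜ* Multiplicative ℤ_[p],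
      (∀ x ∈ GaloisRepresentations.principalIdeles K, f x = 1) ∧
      ∀ (x : GaloisRepresentations.ideleGroup K) (σ : absoluteGaloisGroup K),
        QuotientGroup.mk' (commutator (absoluteGaloisGroup K)).topologicalClosure σ =
          θ (x : GaloisRepresentations.ideleGroup K ⧸ GaloisRepresentations.principalIdeles K) →
          f x = χ σ := by
  -- `χ` factors through `Γ_K^ab`
  have hle : (commutator (absoluteGaloisGroup K)).topologicalClosure ≤ χ.toMonoidHom.ker := by
    refine Subgroup.topologicalClosure_minimal _
      (Abelianization.commutator_subset_ker χ.toMonoidHom) ?_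
    change IsClosed (χ ⁻¹' {1})
    exact (isClosed_singleton (x := (1 : Multiplicative ℤ_[p]))).preimage χ.continuous
  let χab : absoluteGaloisGroupAbelianization K →* Multiplicative ℤ_[p] :=
    QuotientGroup.lift _ χ.toMonoidHom hle
  have hχab : ∀ σ : absoluteGaloisGroup K,
      χab (QuotientGroup.mk' (commutator (absoluteGaloisGroup K)).topologicalClosure σ) = χ σ :=
    fun σ => rfl
  have hχab_cont : Continuous χab :=
    (QuotientGroup.isQuotientMap_mk _).continuous_iff.2 χ.continuous
  let f : GaloisRepresentations.ideleGroup K →ₜ* Multiplicative ℤ_[p] :=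
    ⟨χab.comp (θ.comp (QuotientGroup.mk' (GaloisRepresentations.principalIdeles K))),
      hχab_cont.comp (hθc.comp continuous_quot_mk)⟩
  have hf : ∀ x : GaloisRepresentations.ideleGroup K, f x =
      χab (θ (x : GaloisRepresentations.ideleGroup K ⧸ GaloisRepresentations.principalIdeles K)) :=
    fun x => rfl
  refine ⟨f, fun x hx => ?_, fun x σ hσ => ?_⟩
  · rw [hf, (QuotientGroup.eq_one_iff x).2 hx, map_one, map_one]
  · rw [hf, ← hσ, hχab]

/-! ### The rank bound `rank_{ℤ_p} Hom_cont(Γ_K, ℤ_p) ≤ [K : ℚ]` from a continuous surjection `C_K ↠ Γ_K^ab` -/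

/-- **More than `[K : ℚ]` continuous `ℤ_p`-valued characters of `Γ_K` are `ℤ_p`-linearly
dependent, granted a continuous surjective homomorphism `θ : C_K → Γ_K^ab`** (the tree's
`exists_ne_zero_sum_mul_eq_zero`, with `IsGlobalReciprocityMap K θ` weakened to
`Continuous θ ∧ Surjective θ`, same proof).  Washington, *Introduction to Cyclotomic Fields*,
§13.1, proof of Thm. 13.4: `Hom(Gal(K̃/K), ℤ_p) ↪ Hom(∏_{𝔭∣p} U_𝔭, ℤ_p)` (here: pull back along
`θ`, `exists_idelicCharacter_of_character_of_continuous`, and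
`IdelicCharacter.eq_one_of_forall_localUnits`: an idelic character trivial on `Kˣ` and on the
`𝒪_vˣ`, `v ∣ p`, is trivial) and `rank_{ℤ_p} U_𝔭 = [K_𝔭 : ℚ_p]`, `∑_{𝔭∣p} [K_𝔭:ℚ_p] = [K:ℚ]`
(`OneUnits.exists_continuousMonoidHom_adicCompletionIntegers_rank`, `OneUnits.sum_eq_finrank`);
surjectivity of `θ` recovers the characters of `Γ_K` from their pull-backs.
[cite: Washington1997, §13.1, proof of Thm. 13.4] -/
theorem exists_ne_zero_sum_mul_eq_zero_of_surjective
    {θ : GaloisRepresentations.ideleGroup K ⧸ GaloisRepresentations.principalIdeles K →*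
      absoluteGaloisGroupAbelianization K}
    (hθc : Continuous θ) (hθs : Function.Surjective θ) {m : ℕ}
    (hm : Module.finrank ℚ K < m) (ψ : Fin m → (absoluteGaloisGroup K →ₜ* Multiplicative ℤ_[p])) :
    ∃ a : Fin m → ℤ_[p], a ≠ 0 ∧
      ∀ σ : absoluteGaloisGroup K, ∑ j, a j * (ψ j σ).toAdd = 0 := by
  classical
  have hp : p.Prime := Fact.out
  -- idelic pull-backs of the `ψ j`
  have hf : ∀ j, ∃ f : GaloisRepresentations.ideleGroup K →ₜ* Multiplicative ℤ_[p],
      (∀ x ∈ GaloisRepresentations.principalIdeles K, f x = 1) ∧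
      ∀ (x : GaloisRepresentations.ideleGroup K) (σ : absoluteGaloisGroup K),
        QuotientGroup.mk' (commutator (absoluteGaloisGroup K)).topologicalClosure σ =
          θ (x : GaloisRepresentations.ideleGroup K ⧸ GaloisRepresentations.principalIdeles K) →
          f x = ψ j σ := fun j =>
    exists_idelicCharacter_of_character_of_continuous hθc (ψ j)
  choose f hfprinc hfcomp using hf
  -- the places above `p`
  have hfin : {w : HeightOneSpectrum (𝓞 K) | (p : 𝓞 K) ∈ w.asIdeal}.Finite := by
    have hp0 : (Ideal.span {(p : 𝓞 K)} : Ideal (𝓞 K)) ≠ 0 := by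
      rw [Ne, Ideal.zero_eq_bot, Ideal.span_singleton_eq_bot]
      exact_mod_cast hp.ne_zero
    refine (Ideal.finite_factors hp0).subset fun w hw => ?_
    change w.asIdeal ∣ Ideal.span {(p : 𝓞 K)}
    rw [Ideal.dvd_span_singleton]
    exact hw
  let T : Finset (HeightOneSpectrum (𝓞 K)) := hfin.toFinset
  have hT : ∀ w : HeightOneSpectrum (𝓞 K), (p : 𝓞 K) ∈ w.asIdeal ↔ w ∈ T := fun w => by
    rw [Set.Finite.mem_toFinset]
    rfl
  -- local generators of the character groups of the `𝒪_wˣ`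
  have hloc : ∀ w : HeightOneSpectrum (𝓞 K), ∃ (n N : ℕ)
      (φ : Fin n → ((w.adicCompletionIntegers K)ˣ →ₜ* Multiplicative ℤ_[p])),
      ((p : 𝓞 K) ∈ w.asIdeal →
        Nat.card (w.adicCompletionIntegers K ⧸ Ideal.span {(p : w.adicCompletionIntegers K)}) =
            p ^ n ∧
        ∀ ψ' : (w.adicCompletionIntegers K)ˣ →ₜ* Multiplicative ℤ_[p], ∃ c : Fin n → ℤ_[p],
          ∀ u : (w.adicCompletionIntegers K)ˣ,
            (p : ℤ_[p]) ^ N * (ψ' u).toAdd = ∑ i, c i * (φ i u).toAdd) := by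
    intro w
    by_cases hw : (p : 𝓞 K) ∈ w.asIdeal
    · obtain ⟨n, N, φ, hcard, -, hspan⟩ :=
        GaloisRepresentations.OneUnits.exists_continuousMonoidHom_adicCompletionIntegers_rank
          K w p hw
      exact ⟨n, N, φ, fun _ => ⟨hcard, hspan⟩⟩
    · exact ⟨0, 0, Fin.elim0, fun h => absurd h hw⟩
  choose n N φ hnφ using hloc
  have hsum : ∑ w ∈ T, n w = Module.finrank ℚ K :=
    GaloisRepresentations.OneUnits.sum_eq_finrank K p T (fun w hw => (hT w).1 hw) n
      fun w hw => (hnφ w ((hT w).2 hw)).1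
  -- restrictions of the `f j` to the local units at `w ∈ T`, and their coordinates
  let res : Fin m → ∀ w : HeightOneSpectrum (𝓞 K),
      ((w.adicCompletionIntegers K)ˣ →ₜ* Multiplicative ℤ_[p]) := fun j w =>
    ⟨(f j).toMonoidHom.comp ((GaloisRepresentations.localUnits w).comp
        (Units.map ((w.adicCompletionIntegers K).subtype :
          w.adicCompletionIntegers K →* w.adicCompletion K))),
      (f j).continuous.comp (GaloisRepresentations.IdelicCharacter.continuous_localUnits_unitsMap w)⟩
  have hres : ∀ j w (u : (w.adicCompletionIntegers K)ˣ), res j w u =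
      f j (GaloisRepresentations.localUnits w
        (Units.map ((w.adicCompletionIntegers K).subtype : _ →* _) u)) :=
    fun j w u => rfl
  have hcoord : ∀ (j : Fin m) (w : HeightOneSpectrum (𝓞 K)), w ∈ T → ∃ c : Fin (n w) → ℤ_[p],
      ∀ u : (w.adicCompletionIntegers K)ˣ,
        (p : ℤ_[p]) ^ N w * (res j w u).toAdd = ∑ i, c i * (φ w i u).toAdd := fun j w hw =>
    (hnφ w ((hT w).2 hw)).2 (res j w)
  choose c hc using hcoord
  -- the coefficient vectors are linearly dependent: `m > ∑ n_w = [K:ℚ]`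
  let V : Fin m → ((Σ w : T, Fin (n w)) → ℤ_[p]) := fun j wi => c j wi.1 wi.1.2 wi.2
  have hdep : ¬ LinearIndependent ℤ_[p] V := by
    intro hli
    have h1 := hli.fintype_card_le_finrank
    rw [Module.finrank_fintype_fun_eq_card, Fintype.card_fin, Fintype.card_sigma] at h1
    simp only [Fintype.card_fin] at h1
    rw [Finset.sum_coe_sort T n, hsum] at h1
    omega
  obtain ⟨a, ha, j₀, hj₀⟩ := Fintype.not_linearIndependent_iff.1 hdep
  have haV : ∀ (w : HeightOneSpectrum (𝓞 K)) (hw : w ∈ T) (i : Fin (n w)),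
      ∑ j, a j * c j w hw i = 0 := fun w hw i => by
    have := congrFun ha ⟨⟨w, hw⟩, i⟩
    simpa [V, Finset.sum_apply, Pi.smul_apply, smul_eq_mul] using this
  -- the idelic character `∑ aⱼ fⱼ`
  let G : GaloisRepresentations.ideleGroup K →ₜ* Multiplicative ℤ_[p] :=
    { toFun := fun x => Multiplicative.ofAdd (∑ j, a j * (f j x).toAdd)
      map_one' := by simp
      map_mul' := fun x y => by
        rw [← ofAdd_add, ← Finset.sum_add_distrib]
        congr 1
        refine Finset.sum_congr rfl fun j _ => ?_
        rw [map_mul, toAdd_mul, mul_add]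
      continuous_toFun := continuous_ofAdd.comp (continuous_finsetSum _ fun j _ =>
        continuous_const.mul (continuous_toAdd.comp (f j).continuous)) }
  have hG : ∀ x, (G x).toAdd = ∑ j, a j * (f j x).toAdd := fun x => rfl
  have hGprinc : ∀ x ∈ GaloisRepresentations.principalIdeles K, G x = 1 := fun x hx => by
    apply Multiplicative.toAdd.injective
    rw [hG, toAdd_one]
    exact Finset.sum_eq_zero fun j _ => by rw [hfprinc j x hx, toAdd_one, mul_zero]
  have hGloc : ∀ w : HeightOneSpectrum (𝓞 K), (p : 𝓞 K) ∈ w.asIdeal →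
      ∀ u : (w.adicCompletionIntegers K)ˣ,
        G (GaloisRepresentations.localUnits w
          (Units.map ((w.adicCompletionIntegers K).subtype : _ →* _) u)) = 1 := by
    intro w hw u
    have hwT : w ∈ T := (hT w).1 hw
    apply Multiplicative.toAdd.injective
    rw [hG, toAdd_one]
    -- multiply by `p^{N_w}`
    have hpN : (p : ℤ_[p]) ^ N w ≠ 0 := pow_ne_zero _ (by exact_mod_cast hp.ne_zero)
    refine (mul_eq_zero.1 ?_).resolve_left hpN
    rw [Finset.mul_sum]
    calc ∑ j, (p : ℤ_[p]) ^ N w * (a j * (f j (GaloisRepresentations.localUnits w (Units.map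
            ((w.adicCompletionIntegers K).subtype : _ →* _) u))).toAdd)
        = ∑ j, a j * ∑ i, c j w hwT i * (φ w i u).toAdd := by
          refine Finset.sum_congr rfl fun j _ => ?_
          rw [← hres, mul_left_comm, hc j w hwT u]
      _ = ∑ i, (∑ j, a j * c j w hwT i) * (φ w i u).toAdd := by
          simp_rw [Finset.mul_sum, Finset.sum_mul, mul_assoc]
          rw [Finset.sum_comm]
      _ = 0 := Finset.sum_eq_zero fun i _ => by rw [haV w hwT i, zero_mul]
  have hG1 : G = 1 :=
    GaloisRepresentations.IdelicCharacter.eq_one_of_forall_localUnits (p := p) G hGprinc hGloc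
  refine ⟨a, fun h => hj₀ (by rw [h]; rfl), fun σ => ?_⟩
  obtain ⟨cσ, hcσ⟩ := hθs
    (QuotientGroup.mk' (commutator (absoluteGaloisGroup K)).topologicalClosure σ)
  obtain ⟨x, rfl⟩ := QuotientGroup.mk_surjective cσ
  have h := congrArg Multiplicative.toAdd (DFunLike.congr_fun hG1 x)
  rw [hG] at h
  change ∑ j, a j * (f j x).toAdd = 0 at h
  rw [← h]
  exact Finset.sum_congr rfl fun j _ => by rw [hfcomp j x σ hcσ.symm]

/-! ### Transport along isomorphisms of topological groups and of fields -/

/-- The dependence statement "any `m` continuous characters `G →ₜ* ℤ_p` satisfy a non-trivial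
`ℤ_p`-linear relation" is invariant under isomorphisms of topological groups. [folklore] -/
theorem exists_ne_zero_sum_mul_eq_zero_of_continuousMulEquiv {G : Type u} {H : Type v}
    [Group G] [Group H] [TopologicalSpace G] [TopologicalSpace H] (ι : G ≃ₜ* H) {m : ℕ}
    (h : ∀ ψ : Fin m → (H →ₜ* Multiplicative ℤ_[p]), ∃ a : Fin m → ℤ_[p], a ≠ 0 ∧
      ∀ τ : H, ∑ j, a j * (ψ j τ).toAdd = 0)
    (ψ : Fin m → (G →ₜ* Multiplicative ℤ_[p])) :
    ∃ a : Fin m → ℤ_[p], a ≠ 0 ∧ ∀ σ : G, ∑ j, a j * (ψ j σ).toAdd = 0 := by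
  obtain ⟨a, ha, hrel⟩ := h fun j => (ψ j).comp (ι.symm : H →ₜ* G)
  refine ⟨a, ha, fun σ => ?_⟩
  have hσ := hrel (ι σ)
  have hcomp : ∀ j, ((ψ j).comp (ι.symm : H →ₜ* G)) (ι σ) = ψ j (ι.symm (ι σ)) := fun _ => rfl
  simp only [hcomp, ContinuousMulEquiv.symm_apply_apply] at hσ
  exact hσ

omit [Fact p.Prime] in
/-- Isomorphic number fields have the same degree (a ring isomorphism of `ℚ`-algebras is
`ℚ`-linear, `RingHom.toRatAlgHom`). [folklore] -/
theorem finrank_rat_eq_of_ringEquiv {K' : Type v} [Field K'] [NumberField K'] (e : K ≃+* K') :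
    Module.finrank ℚ K = Module.finrank ℚ K' :=
  LinearEquiv.finrank_eq
    (LinearEquiv.ofBijective ((e : K →+* K').toRatAlgHom.toLinearMap) e.bijective)

end General

/-! ### The rank bound, unconditionally -/

section Unconditional

variable {p : ℕ} [Fact p.Prime]

/-- **Unconditionally: more than `[K : ℚ]` continuous `ℤ_p`-valued characters of `Γ_K` are
`ℤ_p`-linearly dependent** (`rank_{ℤ_p} Hom_cont(Γ_K, ℤ_p) ≤ [K : ℚ]`), for every number field
`K : Type`: `exists_ne_zero_sum_mul_eq_zero_of_surjective` fed with the universal norm residue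
symbol `( , K) = lim ψ_{L|K} : C_K → Γ_K^ab` of the tree's global reciprocity law
(`GaloisRepresentations.isGlobalReciprocitySystem_artinMap K`), which is continuous and
surjective (`GaloisRepresentations.continuous_and_surjective_theta K`; Neukirch III (7.12)
without the existence theorem).  Washington, §13.1, proof of Thm. 13.4:
`rank_{ℤ_p} Gal(K̃/K) ≤ ∑_{𝔭∣p}[K_𝔭:ℚ_p] = [K:ℚ]`.
[cite: Washington1997, §13.1, proof of Thm. 13.4] [cite: Neukirch2013, Part III Thm. (7.12)] -/
theorem exists_ne_zero_sum_mul_eq_zero₀ {K : Type} [Field K] [NumberField K] {m : ℕ}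
    (hm : Module.finrank ℚ K < m) (ψ : Fin m → (absoluteGaloisGroup K →ₜ* Multiplicative ℤ_[p])) :
    ∃ a : Fin m → ℤ_[p], a ≠ 0 ∧
      ∀ σ : absoluteGaloisGroup K, ∑ j, a j * (ψ j σ).toAdd = 0 :=
  exists_ne_zero_sum_mul_eq_zero_of_surjective
    (GaloisRepresentations.continuous_and_surjective_theta K).1
    (GaloisRepresentations.continuous_and_surjective_theta K).2 hm ψ

/-- **The rank bound `rank_{ℤ_p} Hom_cont(Γ_K, ℤ_p) ≤ [K : ℚ]` for number fields in every
universe**, unconditionally: transport `K : Type u` to a model `K₀ : Type`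
(`exists_ringEquiv_numberField_type`), along which `[K : ℚ] = [K₀ : ℚ]` and `Γ_{K₀} ≃ₜ* Γ_K`
(`nonempty_continuousMulEquiv_absoluteGaloisGroup`).
[cite: Washington1997, §13.1, proof of Thm. 13.4] -/
theorem exists_ne_zero_sum_mul_eq_zero' {K : Type u} [Field K] [NumberField K] {m : ℕ}
    (hm : Module.finrank ℚ K < m) (ψ : Fin m → (absoluteGaloisGroup K →ₜ* Multiplicative ℤ_[p])) :
    ∃ a : Fin m → ℤ_[p], a ≠ 0 ∧
      ∀ σ : absoluteGaloisGroup K, ∑ j, a j * (ψ j σ).toAdd = 0 := by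
  obtain ⟨K₀, _, _, ⟨e⟩⟩ := exists_ringEquiv_numberField_type K
  obtain ⟨ι⟩ := nonempty_continuousMulEquiv_absoluteGaloisGroup e
  have hm₀ : Module.finrank ℚ K₀ < m := finrank_rat_eq_of_ringEquiv e ▸ hm
  exact exists_ne_zero_sum_mul_eq_zero_of_continuousMulEquiv ι.symm
    (fun ψ₀ => exists_ne_zero_sum_mul_eq_zero₀ hm₀ ψ₀) ψ

end Unconditional

/-! ### Washington Thm. 13.4, upper bound, for `[K : ℚ] ≤ 2` -/

section UpperBound

variable {K : Type u} [Field K] [NumberField K] {p : ℕ} [Fact p.Prime]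

/-- **The compositum of two independent `ℤ_p`-extensions of a field of degree `≤ 2` contains every
`ℤ_p`-extension** (unconditionally).  If `κ₁, κ₂ : ZpExtension K p` have
`(κ₁, κ₂) : Γ_K → ℤ_p × ℤ_p` surjective and `[K : ℚ] ≤ 2`, then `ker κ₁ ⊓ ker κ₂ ≤ ker κ` for
every `ℤ_p`-extension `κ` of `K` — the upper bound `rank_{ℤ_p} Gal(K̃/K) ≤ 2` of Washington,
Thm. 13.4 for imaginary quadratic `K` (`r₂ + 1 = 2`; for real quadratic `K` the sharp value is
`1 + δ`).  Proof as in the tree's `zpRank_imaginaryQuadratic_of_globalReciprocity`: by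
`exists_ne_zero_sum_mul_eq_zero'` the three characters `κ, κ₁, κ₂` satisfy
`a₀κ + a₁κ₁ + a₂κ₂ = 0` with `a ≠ 0`; joint surjectivity of `(κ₁, κ₂)` forces `a₀ ≠ 0`, so `κ`
vanishes on `ker κ₁ ⊓ ker κ₂` (`ℤ_p` is a domain).
[cite: Washington1997, Thm. 13.4] [cite: Lang1990, Ch. 5 §5 Thm. 5.2] -/
theorem kerSubgroup_inf_le_kerSubgroup_of_surjective (hK : Module.finrank ℚ K ≤ 2)
    {κ₁ κ₂ : ZpExtension K p}
    (hsurj : Function.Surjective fun σ : absoluteGaloisGroup K => (κ₁ σ, κ₂ σ))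
    (κ : ZpExtension K p) : κ₁.kerSubgroup ⊓ κ₂.kerSubgroup ≤ κ.kerSubgroup := by
  classical
  intro σ hσ
  rw [Subgroup.mem_inf, mem_kerSubgroup, mem_kerSubgroup] at hσ
  -- a non-trivial relation among `κ, κ₁, κ₂`
  let ψ : Fin 3 → (absoluteGaloisGroup K →ₜ* Multiplicative ℤ_[p]) :=
    ![κ.toContinuousMonoidHom, κ₁.toContinuousMonoidHom, κ₂.toContinuousMonoidHom]
  obtain ⟨a, ha, hrel⟩ := exists_ne_zero_sum_mul_eq_zero' (p := p) (m := 3) (by omega) ψ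
  have hrel' : ∀ τ : absoluteGaloisGroup K,
      a 0 * (κ τ).toAdd + a 1 * (κ₁ τ).toAdd + a 2 * (κ₂ τ).toAdd = 0 := fun τ => by
    have h := hrel τ
    simp only [Fin.sum_univ_three, ψ, Matrix.cons_val_zero, Matrix.cons_val_one,
      Matrix.cons_val_two, Matrix.head_cons, Matrix.tail_cons] at h
    exact h
  -- `a 0 ≠ 0` by joint surjectivity of `(κ₁, κ₂)`
  have ha0 : a 0 ≠ 0 := by
    intro ha0
    obtain ⟨τ₁, hτ₁⟩ := hsurj (Multiplicative.ofAdd 1, 1)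
    obtain ⟨τ₂, hτ₂⟩ := hsurj (1, Multiplicative.ofAdd 1)
    have h1 := hrel' τ₁
    have h2 := hrel' τ₂
    simp only [Prod.mk.injEq] at hτ₁ hτ₂
    rw [ha0, zero_mul, zero_add, hτ₁.1, hτ₁.2, toAdd_ofAdd, toAdd_one, mul_one, mul_zero,
      add_zero] at h1
    rw [ha0, zero_mul, zero_add, hτ₂.1, hτ₂.2, toAdd_ofAdd, toAdd_one, mul_one, mul_zero,
      zero_add] at h2
    apply ha
    funext i
    fin_cases i
    · simpa using ha0
    · simpa using h1
    · simpa using h2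
  -- conclude on `ker κ₁ ⊓ ker κ₂`
  have h := hrel' σ
  rw [show (κ₁ σ).toAdd = 0 from (congrArg Multiplicative.toAdd hσ.1).trans toAdd_one,
    show (κ₂ σ).toAdd = 0 from (congrArg Multiplicative.toAdd hσ.2).trans toAdd_one,
    mul_zero, mul_zero, add_zero, add_zero] at h
  rw [mem_kerSubgroup]
  apply Multiplicative.toAdd.injective
  rw [toAdd_one]
  exact (mul_eq_zero.1 h).resolve_left ha0

end UpperBound

end Literature.NumberTheory.EllipticCurves.ZpExtension

/-! ### What remains for `zpRank_imaginaryQuadratic_holds`: the lower bound -/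

namespace Literature.NumberTheory.EllipticCurves

open ZpExtension

universe w

variable {K : Type w} [Field K] [NumberField K] {p : ℕ} [Fact p.Prime]

/-- **`zpRank_imaginaryQuadratic` from its lower-bound half alone.**  If the imaginary quadratic
field `K` has two `ℤ_p`-extensions `κ₁, κ₂` with `(κ₁, κ₂) : Γ_K → ℤ_p × ℤ_p` surjective
(`rank_{ℤ_p} Gal(K̃/K) ≥ 2 = r₂ + 1`: the existence half of Washington Thm. 13.4, i.e. the
existence theorem of global class field theory applied to `C_K → ∏_{𝔭∣p} U_𝔭/(roots of unity)`),
then `zpRank_imaginaryQuadratic K p` holds — the upper bound is the unconditional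
`ZpExtension.kerSubgroup_inf_le_kerSubgroup_of_surjective`.
[cite: Washington1997, Thm. 13.4] [cite: Lang1990, Ch. 5 §5 Thm. 5.2] -/
theorem zpRank_imaginaryQuadratic_of_exists_pair
    (h : Module.finrank ℚ K = 2 → (∀ w : NumberField.InfinitePlace K, w.IsComplex) →
      ∃ κ₁ κ₂ : ZpExtension K p,
        Function.Surjective fun σ : absoluteGaloisGroup K => (κ₁ σ, κ₂ σ)) :
    zpRank_imaginaryQuadratic K p := by
  intro hK himag
  obtain ⟨κ₁, κ₂, hsurj⟩ := h hK himag
  exact ⟨κ₁, κ₂, hsurj, fun κ => kerSubgroup_inf_le_kerSubgroup_of_surjective hK.le hsurj κ⟩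

/-- **`zpRank_imaginaryQuadratic` from two jointly surjective continuous characters
`Γ_K →ₜ* ℤ_p`** (the shape delivered by the tree's
`ZpExtension.exists_pair_of_globalReciprocity hK h0 : exists_isGlobalReciprocityMap K → …`, with
`h0 : NumberField.Units.rank K = 0` automatic for imaginary quadratic `K`,
`units_rank_eq_zero_of_finrank_eq_two`): each component is then surjective, hence a
`ℤ_p`-extension, and the upper bound is unconditional.  So the discharge
`zpRank_imaginaryQuadratic_holds` needs exactly the existence of such a pair — the existence
theorem of global class field theory (Neukirch III (7.7)–(7.8)), cf.
`GaloisRepresentations.exists_isGlobalReciprocityMap_of_kummer`.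
[cite: Washington1997, Thm. 13.4] [cite: Neukirch2013, Part III Thm. (7.8), (7.12)] -/
theorem zpRank_imaginaryQuadratic_of_exists_pair'
    (h : Module.finrank ℚ K = 2 → NumberField.Units.rank K = 0 →
      ∃ κ₁ κ₂ : absoluteGaloisGroup K →ₜ* Multiplicative ℤ_[p],
        Function.Surjective fun σ => ((κ₁ σ).toAdd, (κ₂ σ).toAdd)) :
    zpRank_imaginaryQuadratic K p := by
  refine zpRank_imaginaryQuadratic_of_exists_pair fun hK himag => ?_
  have h0 : NumberField.Units.rank K = 0 := units_rank_eq_zero_of_finrank_eq_two hK himag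
  obtain ⟨κ₁, κ₂, hsurj⟩ := h hK h0
  have hsurj₁ : Function.Surjective κ₁ := fun y => by
    obtain ⟨σ, hσ⟩ := hsurj (y.toAdd, 0)
    exact ⟨σ, Multiplicative.toAdd.injective (congrArg Prod.fst hσ)⟩
  have hsurj₂ : Function.Surjective κ₂ := fun y => by
    obtain ⟨σ, hσ⟩ := hsurj (0, y.toAdd)
    exact ⟨σ, Multiplicative.toAdd.injective (congrArg Prod.snd hσ)⟩
  refine ⟨⟨κ₁, hsurj₁⟩, ⟨κ₂, hsurj₂⟩, ?_⟩
  rintro ⟨y₁, y₂⟩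
  obtain ⟨σ, hσ⟩ := hsurj (y₁.toAdd, y₂.toAdd)
  refine ⟨σ, Prod.ext ?_ ?_⟩
  · exact Multiplicative.toAdd.injective (congrArg Prod.fst hσ)
  · exact Multiplicative.toAdd.injective (congrArg Prod.snd hσ)

/-- **The conditional discharge through the new reduction** — DUPLICATE (dedup-00637): the
statement `exists_isGlobalReciprocityMap K → zpRank_imaginaryQuadratic K p` is literally that of
the tree's `zpRank_imaginaryQuadratic_of_globalReciprocity`
(`IwasawaZpRankGlobalReciprocityProofs.lean`), so this name is kept only as a deprecated alias of
it. The alternative route it recorded (the reciprocity law gives the pair,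
`exists_pair_of_globalReciprocity`, then `zpRank_imaginaryQuadratic_of_exists_pair'`, using the
named fact only for the lower bound) is the two-line composition
`zpRank_imaginaryQuadratic_of_exists_pair' fun hK h0 => exists_pair_of_globalReciprocity hK h0 hGR`
of the two theorems above, both of which stay.
[cite: Washington1997, Thm. 13.4] [cite: Neukirch2013, Part III Thm. (7.12)] -/
@[deprecated (since := "2026-08-15")]
alias zpRank_imaginaryQuadratic_of_globalReciprocity' := zpRank_imaginaryQuadratic_of_globalReciprocity

end Literature.NumberTheory.EllipticCurves

end
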